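import Mathlib.Computability.MyhillNerode
import Mathlib.Data.Finite.Prod
import Mathlib.Data.Fintype.Pi
import Literature.Computability.Complexity.AutomaticSequences
import HarnessLib

/-!
# Proof of `Literature.Computability.Complexity.allouche_shallit_twoKernel_finite_iff_fibres_regular`

`allouche_shallit_twoKernel_finite_iff_fibres_regular_holds` discharges the named fact vendored in
`AutomaticSequences.lean`: a sequence `a : ℕ → Δ` over a finite alphabet has finite `2`-kernel
(`IsKAutomatic 2 a`) iff for every `d : Δ` the language `{encodeNat n : a n = d}` of canonical
least-significant-digit-first binary numerals is regular (J.-P. Allouche, J. Shallit, *Automatic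
Sequences*, CUP 2003 [AlloucheShallit2003]: Lemma 5.2.6, p. 166, with Theorem 6.6.2, pp. 185–186;
the kernel theorem is due to Eilenberg 1974, Prop. V.3.3, and Christol 1979, see p. 207).

## The printed proof and this formalization

Theorem 6.6.2 is proved in the book with least-significant-digit-first DFAOs (Theorem 5.2.3):
"⟹": the state `q = δ(q₀, wᴿ)`, `|w| = i`, `[w]_k = j`, generates the kernel sequence
`(u_{k^i n + j})_n` because `(k^i · n + j)_k = (n)_k w` for `n > 0` (and `n = 0` is checked
separately); "⟸": the classes of `w ≡ x ⟺ ∀ n, u_{k^{|w|} n + [w]} = u_{k^{|x|} n + [x]}` are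
finitely many and form a DFAO reading `wᴿ`. Lemma 5.2.6 passes between a DFAO and the regularity
of all fibres. We eliminate the automata: by Mathlib's Myhill–Nerode theorem
(`Language.isRegular_iff_finite_range_leftQuotient`) a language is regular iff it has finitely many
left quotients, and the left quotients of the LSB-first fibre languages play the role of the DFAO
states. The arithmetic input is the same identity, `append_encodeNat :
w ++ encodeNat n = encodeNat (2^|w| · n + [w])` for `n ≠ 0`, proved from the bit recursion of
Mathlib's `Num`-based `encodeNat` (`Num.ofNat'_bit`).

Nothing is assumed; no definitions or named facts are introduced (all helpers are private lemmas).
-/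

namespace Literature.Computability.Complexity

/-! ### The argument

We follow the printed proof of Allouche–Shallit, Theorem 6.6.2 (pp. 185–186 of the book), with the
states of the least-significant-digit-first DFAO replaced by the Nerode left quotients of the fibre
languages (Mathlib's Myhill–Nerode theorem `Language.isRegular_iff_finite_range_leftQuotient`,
which is also how Lemma 5.2.6 / Theorem 4.1.8 produce the automaton). The one arithmetic input is
the identity `(k^i · n + j)_k = (n)_k w` for `n > 0`, `|w| = i`, `[w]_k = j` (book, proof of
Theorem 6.6.2, "⟹"), here in LSB-first form: `w ++ encodeNat n = encodeNat (2^|w| · n + [w])`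
(`append_encodeNat`).

* (kernel finite ⟹ fibres regular): the left quotient of the fibre `L_d` by a word `x` is
  determined by the kernel element `n ↦ a (2^|x| n + [x])` (suffixes `y ≠ ε`, which must be
  canonical numerals of some `m ≥ 1`) together with the bit `x ∈ L_d` (suffix `y = ε`; the book's
  separate treatment of `n = 0`). Finitely many data, so finitely many quotients.
* (fibres regular ⟹ kernel finite): the kernel element `(i, j)` is determined by the tuple of left
  quotients `(L_d.leftQuotient w)_{d ∈ Δ}`, `w` the `i`-bit word of `j` (values at `n ≥ 1`), and by
  `a j ∈ Δ` (value at `n = 0`). Finitely many data since `Δ` is finite and each `L_d` has finitely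
  many quotients (the book's equivalence `w ≡ x`).
-/

section AlloucheShallitProof

open _root_.Computability

/-- Bit recursion of Mathlib's canonical binary numerals: for `2n + b ≠ 0`,
`encodeNat (2n + b) = b :: encodeNat n` (LSB first). [folklore] -/
private theorem encodeNat_bit (b : Bool) (n : ℕ) (h : Nat.bit b n ≠ 0) :
    encodeNat (Nat.bit b n) = b :: encodeNat n := by
  have hcast : ((Nat.bit b n : ℕ) : Num) = cond b Num.bit1 Num.bit0 (n : Num) := by
    rw [← Num.ofNat'_eq, Num.ofNat'_bit, Num.ofNat'_eq]
  unfold encodeNat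
  rw [hcast]
  cases b with
  | false =>
    have hn : n ≠ 0 := by
      rintro rfl
      exact h rfl
    cases hm : (n : Num) with
    | zero =>
      exfalso
      apply hn
      rw [← @Num.of_nat_inj n 0, hm, Nat.cast_zero]
      rfl
    | pos p => rfl
  | true =>
    cases hm : (n : Num) with
    | zero => rfl
    | pos p => rfl

/-- `encodeNat 0 = ε`. [folklore] -/
private theorem encodeNat_zero' : encodeNat 0 = [] := by
  unfold encodeNat
  rw [Nat.cast_zero]
  rfl

/-- The book's identity `(k^i · n + j)_k = (n)_k w` (`n > 0`, `|w| = i`, `[w]_k = j`; proof of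
Theorem 6.6.2), base `2`, least significant digit first: appending the canonical numeral of
`m ≠ 0` to a word `x` gives the canonical numeral of `2^|x| · m + [x]`.
[cite: AlloucheShallit2003, proof of Theorem 6.6.2] -/
private theorem append_encodeNat (x : List Bool) {m : ℕ} (hm : m ≠ 0) :
    x ++ encodeNat m = encodeNat (2 ^ x.length * m + bitsToNat x) := by
  induction x with
  | nil => simp
  | cons b x ih =>
    rw [List.cons_append, ih, List.length_cons, bitsToNat_cons]
    have hN : 2 ^ x.length * m + bitsToNat x ≠ 0 := by
      have := Nat.pos_of_ne_zero hm
      positivity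
    have key : 2 ^ (x.length + 1) * m + (b.toNat + 2 * bitsToNat x) =
        Nat.bit b (2 ^ x.length * m + bitsToNat x) := by
      rw [Nat.bit_val]
      ring
    rw [key, encodeNat_bit]
    exact Nat.bit_ne_zero_iff.mpr fun h => absurd h hN

/-- Canonical numerals of positive numbers end in the digit `1` (no leading zeros, §3.1).
[folklore] -/
private theorem getLast?_encodeNat {n : ℕ} (hn : n ≠ 0) : (encodeNat n).getLast? = some true := by
  induction n using Nat.binaryRec with
  | zero => exact absurd rfl hn
  | bit b n ih =>
    rw [encodeNat_bit b n hn, ← List.singleton_append, List.getLast?_append]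
    by_cases h0 : n = 0
    · subst h0
      have hb : b = true := Nat.bit_ne_zero_iff.mp hn rfl
      subst hb
      simp [encodeNat_zero']
    · simp [ih h0]

/-- `encodeNat n ≠ ε` for `n ≠ 0`. [folklore] -/
private theorem encodeNat_ne_nil {n : ℕ} (hn : n ≠ 0) : encodeNat n ≠ [] := fun h =>
  hn (by simpa [h] using (bitsToNat_encodeNat n).symm)

/-- `encodeNat` is injective (it has the left inverse `bitsToNat`). [folklore] -/
private theorem encodeNat_inj' {m n : ℕ} (h : encodeNat m = encodeNat n) : m = n := by
  rw [← bitsToNat_encodeNat m, h, bitsToNat_encodeNat]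

/-- Membership in the fibre language `{encodeNat n : a n = d}`, unfolded. [folklore] -/
private theorem mem_fibre_iff {Δ : Type} (a : ℕ → Δ) (d : Δ) (w : List Bool) :
    w ∈ encodingNatBool.toLanguage {n : ℕ | a n = d} ↔ ∃ n, a n = d ∧ encodeNat n = w :=
  Iff.rfl

/-- Suffix test for the fibre `L_d = {encodeNat n : a n = d}`: for a NONEMPTY suffix `y`,
`x ++ y ∈ L_d` iff `y` is the canonical numeral of some `m ≥ 1` with `a (2^|x| · m + [x]) = d`
(the value of the kernel element `(|x|, [x])` at `m`). This is the content of the "⟹" half of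
the printed proof of Theorem 6.6.2 (case `n > 0`). [cite: AlloucheShallit2003, proof of Theorem 6.6.2] -/
private theorem append_mem_fibre_iff {Δ : Type} (a : ℕ → Δ) (d : Δ) (x y : List Bool)
    (hy : y ≠ []) :
    x ++ y ∈ encodingNatBool.toLanguage {n : ℕ | a n = d} ↔
      ∃ m, m ≠ 0 ∧ encodeNat m = y ∧ a (2 ^ x.length * m + bitsToNat x) = d := by
  rw [mem_fibre_iff]
  constructor
  · rintro ⟨n, hd, hxy⟩
    have hn0 : n ≠ 0 := by
      rintro rfl
      rw [encodeNat_zero'] at hxy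
      exact hy (List.append_eq_nil_iff.mp hxy.symm).2
    have hval : n = bitsToNat x + 2 ^ x.length * bitsToNat y := by
      rw [← bitsToNat_append, ← hxy, bitsToNat_encodeNat]
    have hlast : y.getLast? = some true := by
      have h := getLast?_encodeNat hn0
      rw [hxy, List.getLast?_append] at h
      cases hy' : y.getLast? with
      | none => exact absurd (List.getLast?_eq_none_iff.mp hy') hy
      | some c => simpa [hy'] using h
    obtain ⟨y', rfl⟩ := List.getLast?_eq_some_iff.mp hlast
    have hm : bitsToNat (y' ++ [true]) ≠ 0 := by
      simp [bitsToNat_append]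
    refine ⟨bitsToNat (y' ++ [true]), hm, ?_, ?_⟩
    · apply List.append_cancel_left (as := x)
      rw [append_encodeNat x hm, ← hxy, hval, add_comm]
    · rw [← hd, hval, add_comm]
  · rintro ⟨m, hm, rfl, hd⟩
    exact ⟨_, hd, (append_encodeNat x hm).symm⟩

/-- Every `j < 2^i` is `[w]_2` for some word `w` of length exactly `i` (its `i` low binary digits,
least significant first; the book's `w = 0^t (j)_k`, reversed). [folklore] -/
private theorem exists_word_length_eq_bitsToNat_eq :
    ∀ i j : ℕ, j < 2 ^ i → ∃ w : List Bool, w.length = i ∧ bitsToNat w = j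
  | 0, j, h => ⟨[], rfl, by
      simp only [pow_zero, Nat.lt_one_iff] at h
      simp [h]⟩
  | i + 1, j, h => by
    have hj : j / 2 < 2 ^ i := by
      rw [pow_succ] at h
      omega
    obtain ⟨w, hw, hv⟩ := exists_word_length_eq_bitsToNat_eq i (j / 2) hj
    refine ⟨decide (j % 2 = 1) :: w, by simp [hw], ?_⟩
    rw [bitsToNat_cons, hv]
    rcases Nat.mod_two_eq_zero_or_one j with h0 | h1
    · simp [h0]
      omega
    · simp [h1]
      omega

/-- A map `F` that factors through a map `ψ` of finite range has finite range. [folklore] -/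
private theorem finite_range_of_factorsThrough {ι β γ : Type*} (ψ : ι → β) (F : ι → γ)
    (j : β → γ) (hfin : (Set.range ψ).Finite) (h : Function.FactorsThrough F ψ) :
    (Set.range F).Finite := by
  refine (hfin.image (Function.extend ψ F j)).subset ?_
  rintro _ ⟨i, rfl⟩
  exact ⟨ψ i, ⟨i, rfl⟩, h.extend_apply j i⟩

/-- **Finite `2`-kernel ⟹ regular fibres** (Theorem 6.6.2 "⟸" with Lemma 5.2.6 "⟹", via
Myhill–Nerode): the left quotient of `L_d` by `x` is determined by the pair
(`x ∈ L_d`, kernel element `(|x|, [x])`). [cite: AlloucheShallit2003, Theorem 6.6.2 and Lemma 5.2.6] -/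
private theorem fibre_isRegular_of_isKAutomatic {Δ : Type} (a : ℕ → Δ) (hfin : IsKAutomatic 2 a)
    (d : Δ) : (encodingNatBool.toLanguage {n : ℕ | a n = d}).IsRegular := by
  set L := encodingNatBool.toLanguage {n : ℕ | a n = d} with hL
  apply Language.IsRegular.of_finite_range_leftQuotient
  let ψ : List Bool → Prop × (ℕ → Δ) := fun x =>
    (x ∈ L, fun n => a (2 ^ x.length * n + bitsToNat x))
  have hψ : (Set.range ψ).Finite := by
    refine (Set.finite_univ.prod hfin).subset ?_
    rintro _ ⟨x, rfl⟩
    exact ⟨Set.mem_univ _, x.length, bitsToNat x, bitsToNat_lt x, rfl⟩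
  refine finite_range_of_factorsThrough ψ _ (fun _ => L) hψ ?_
  intro x x' hxx'
  simp only [ψ, Prod.mk.injEq] at hxx'
  obtain ⟨h0, h1⟩ := hxx'
  ext y
  simp only [Language.mem_leftQuotient]
  rcases eq_or_ne y [] with rfl | hy
  · simp only [List.append_nil]
    exact Iff.of_eq h0
  · rw [hL, append_mem_fibre_iff a d x y hy, append_mem_fibre_iff a d x' y hy]
    refine exists_congr fun m => ?_
    rw [show a (2 ^ x.length * m + bitsToNat x) = a (2 ^ x'.length * m + bitsToNat x') from
      congr_fun h1 m]

/-- **Regular fibres ⟹ finite `2`-kernel** (Lemma 5.2.6 "⟸" with Theorem 6.6.2 "⟹", via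
Myhill–Nerode): the kernel element `(i, j)` is determined by `a j` and the tuple of left
quotients of the fibres by the `i`-bit word of `j`. [cite: AlloucheShallit2003, Theorem 6.6.2 and Lemma 5.2.6] -/
private theorem isKAutomatic_of_fibres_isRegular {Δ : Type} [Fintype Δ] (a : ℕ → Δ)
    (hreg : ∀ d : Δ, (encodingNatBool.toLanguage {n : ℕ | a n = d}).IsRegular) :
    IsKAutomatic 2 a := by
  set L : Δ → Language Bool := fun d => encodingNatBool.toLanguage {n : ℕ | a n = d} with hL
  have hfinQ : ∀ d, (Set.range (L d).leftQuotient).Finite := fun d =>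
    (hreg d).finite_range_leftQuotient
  let ι := {p : ℕ × ℕ // p.2 < 2 ^ p.1}
  let F : ι → (ℕ → Δ) := fun p n => a (2 ^ p.1.1 * n + p.1.2)
  have hK : kKernel 2 a = Set.range F := by
    ext f
    simp only [mem_kKernel_iff, Set.mem_range]
    constructor
    · rintro ⟨l, r, hr, rfl⟩
      exact ⟨⟨(l, r), hr⟩, rfl⟩
    · rintro ⟨⟨⟨l, r⟩, hr⟩, rfl⟩
      exact ⟨l, r, hr, rfl⟩
  have hw : ∀ q : ι, ∃ w : List Bool, w.length = q.1.1 ∧ bitsToNat w = q.1.2 := fun q =>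
    exists_word_length_eq_bitsToNat_eq q.1.1 q.1.2 q.2
  let ψ : ι → Δ × (Δ → Language Bool) := fun p =>
    (a p.1.2, fun d => (L d).leftQuotient (hw p).choose)
  have hψ : (Set.range ψ).Finite := by
    refine (Set.finite_univ.prod (Set.Finite.pi fun d => hfinQ d)).subset ?_
    rintro _ ⟨p, rfl⟩
    exact ⟨Set.mem_univ _, fun d _ => ⟨_, rfl⟩⟩
  have key : ∀ (q : ι) (d : Δ) {n : ℕ}, n ≠ 0 →
      (a (2 ^ q.1.1 * n + q.1.2) = d ↔ encodeNat n ∈ (L d).leftQuotient (hw q).choose) := by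
    intro q d n hn
    rw [Language.mem_leftQuotient, hL, append_mem_fibre_iff a d _ _ (encodeNat_ne_nil hn),
      (hw q).choose_spec.1, (hw q).choose_spec.2]
    constructor
    · intro h
      exact ⟨n, hn, rfl, h⟩
    · rintro ⟨m, -, hm, h⟩
      rwa [encodeNat_inj' hm] at h
  unfold IsKAutomatic
  rw [hK]
  refine finite_range_of_factorsThrough ψ F (fun _ => a) hψ ?_
  intro p p' hpp'
  simp only [ψ, Prod.mk.injEq] at hpp'
  obtain ⟨h0, h1⟩ := hpp'
  funext n
  simp only [F]
  rcases eq_or_ne n 0 with rfl | hn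
  · simpa using h0
  · have h := (key p (a (2 ^ p.1.1 * n + p.1.2)) hn).mp rfl
    rw [congr_fun h1 (a (2 ^ p.1.1 * n + p.1.2))] at h
    exact ((key p' _ hn).mpr h).symm

/-- **Allouche–Shallit 2003, Lemma 5.2.6 with Theorem 6.6.2, base `2` — proved.** A sequence
`a : ℕ → Δ` over a finite alphabet has finite `2`-kernel iff every fibre
`{encodeNat n : a n = d}` (canonical binary numerals, least significant digit first) is a regular
language. Proof: Myhill–Nerode (`Language.isRegular_iff_finite_range_leftQuotient`) on both
sides, following the printed proof of Theorem 6.6.2 (Eilenberg 1974, Prop. V.3.3; Christol 1979)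
with DFAO states replaced by left quotients; see `fibre_isRegular_of_isKAutomatic` and
`isKAutomatic_of_fibres_isRegular`. [cite: AlloucheShallit2003, Lemma 5.2.6 and Theorem 6.6.2] -/
theorem allouche_shallit_twoKernel_finite_iff_fibres_regular_holds :
    allouche_shallit_twoKernel_finite_iff_fibres_regular := by
  intro Δ _ a
  exact ⟨fun h d => fibre_isRegular_of_isKAutomatic a h d, isKAutomatic_of_fibres_isRegular a⟩

end AlloucheShallitProof

end Literature.Computability.Complexity
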